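import Mathlib.GroupTheory.PGroup
import Mathlib.Data.Int.GCD
import Summits.MatrixMultiplication.OmegaCensus.BoxBadOddPGroupsEmbed

/-!
# ω-census, family (b3): conjecture C9 on odd `p`-groups — the structure of a minimal counterexample

HONEST FRAMING (pub-omega census; verbatim): lottery ticket; floor = certified bounds/negative ranges.
Census BOOKKEEPING (conjecture C9 of the cell; pub-omega kernel-l4 gen 14, task K-3 file 2 of 3).  A *minimal bad configuration*
is a finite non-abelian `p`-group all of whose PROPER quotients are abelian, stated without quotient types as the hypothesis
`hquot : every commutator a b a⁻¹ b⁻¹ lies in every non-trivial normal subgroup` — what a smallest non-abelian `p`-group that might be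
box-useful must look like, since box-usefulness passes to quotients (C9 (a): `BoxUseful.quotient`).  Elementary structure, proved
here without any classification (no new definitions; hypotheses are threaded explicitly):
* `comm_mem_center`: every commutator is central (the centre is a non-trivial normal subgroup); `comm_mem_zpowers_of_central`: every
  commutator lies in `⟨w⟩` for every central `w ≠ 1`;
* `eq_one_of_mem_zpowers_pow` (any `p`-group): `g ∈ ⟨g^p⟩ ⇒ g = 1`; hence `comm_pow_p` : commutators have order dividing `p`, and
  `pow_p_mem_center`: `p`-th powers are central (`[g^p, w] = [g, w]^p = 1`);
* `exists_zpowers_eq_center`: **the centre is cyclic** — an abelian `p`-group in which one element `c ≠ 1` of order `p` lies in every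
  non-trivial cyclic subgroup is generated by any element of maximal order (`exists_generator_of_forall_mem_zpowers`);
* **`not_boxUseful_of_quot_comm`** (`p ≥ 3` prime): DICHOTOMY — either every `p`-th power is the `p`-th power of a central element, and then
  correcting two non-commuting generators by central elements gives `x^p = y^p = 1` with non-trivial central commutator, i.e. a faithful
  `He_p` (`not_boxUseful_of_heis_generators`); or some `g` has `g^p` outside `Z^p`, then `Z = ⟨g^p⟩`, `g` has order `p^m` with `m ≥ 2`,
  a non-commuting `h₀` conjugates `g` to `g^{1+e p^{m-1}}` (`p ∤ e`), and correcting `h₀` by a power of `g` (Hall's formula, `p` odd) and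
  raising to the inverse of `e` mod `p` gives `h` of order `p` outside `⟨g⟩` with `h g h⁻¹ = g^{1+p^{m-1}}`, i.e. a faithful `M_p(m,1)`
  (`not_boxUseful_of_mmeta_generators`).  Either way `G` is NOT box-useful.
File 3 (`BoxBadOddPGroups`) runs the induction on `|G|`.  Nothing here is progress on `ω`.
-/

namespace Summit.MatrixMultiplication.OmegaCensus

open Finset ProductBoxBound

namespace OddPGroup

variable {G : Type*} [Group G] {p : ℕ}

/-! ### Generic lemmas -/

/-- A subgroup of the centre is normal. [folklore] -/
theorem normal_of_le_center {K : Subgroup G} (hK : K ≤ Subgroup.center G) : K.Normal :=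
  ⟨fun n hn g => by rw [central_comm (hK hn) g, mul_inv_cancel_right]; exact hn⟩

/-- In a finite group, membership in `⟨g⟩` is witnessed by a natural exponent. [folklore] -/
theorem exists_pow_eq_of_mem_zpowers [Finite G] {g w : G} (h : w ∈ Subgroup.zpowers g) : ∃ n : ℕ, g ^ n = w := by
  rw [← mem_powers_iff_mem_zpowers] at h
  exact (Submonoid.mem_powers_iff _ _).mp h

/-- Multiplying an argument of a commutator by a central element does not change it (right factor of the first argument). [folklore] -/
theorem comm_mul_central_left {x y z : G} (hz : z ∈ Subgroup.center G) :
    (y * z) * x * (y * z)⁻¹ * x⁻¹ = y * x * y⁻¹ * x⁻¹ := by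
  have h := central_comm hz x
  calc (y * z) * x * (y * z)⁻¹ * x⁻¹ = y * (z * x) * z⁻¹ * y⁻¹ * x⁻¹ := by group
    _ = y * (x * z) * z⁻¹ * y⁻¹ * x⁻¹ := by rw [h]
    _ = y * x * y⁻¹ * x⁻¹ := by group

/-- Multiplying an argument of a commutator by a central element does not change it (right factor of the second argument). [folklore] -/
theorem comm_mul_central_right {x y z : G} (hz : z ∈ Subgroup.center G) :
    y * (x * z) * y⁻¹ * (x * z)⁻¹ = y * x * y⁻¹ * x⁻¹ := by
  have h := central_comm hz (y⁻¹ * z⁻¹ * x⁻¹)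
  calc y * (x * z) * y⁻¹ * (x * z)⁻¹ = y * x * (z * (y⁻¹ * z⁻¹ * x⁻¹)) := by group
    _ = y * x * ((y⁻¹ * z⁻¹ * x⁻¹) * z) := by rw [← h]
    _ = y * x * y⁻¹ * x⁻¹ := by
        have h2 := central_comm hz x⁻¹
        calc y * x * ((y⁻¹ * z⁻¹ * x⁻¹) * z) = y * x * y⁻¹ * z⁻¹ * (x⁻¹ * z) := by group
          _ = y * x * y⁻¹ * z⁻¹ * (z * x⁻¹) := by rw [h2]
          _ = y * x * y⁻¹ * x⁻¹ := by group

/-- **In a `p`-group, `g ∈ ⟨g^p⟩` forces `g = 1`** (`p` prime): the order of `g` would divide `p k - 1` and be a positive power of `p`.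
[folklore] -/
theorem eq_one_of_mem_zpowers_pow [hp : Fact p.Prime] (hG : IsPGroup p G) {g : G} (h : g ∈ Subgroup.zpowers (g ^ p)) : g = 1 := by
  obtain ⟨k, hk⟩ := Subgroup.mem_zpowers_iff.mp h
  obtain ⟨j, hj⟩ := (IsPGroup.iff_orderOf.mp hG) g
  by_contra hne
  have hj0 : j ≠ 0 := by
    rintro rfl
    rw [pow_zero, orderOf_eq_one_iff] at hj
    exact hne hj
  -- `g ^ (p k - 1) = 1`
  have h1 : g ^ ((p : ℤ) * k - 1) = 1 := by
    rw [zpow_sub_one, zpow_mul, zpow_natCast, hk, mul_inv_cancel]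
  have hdvd : (orderOf g : ℤ) ∣ (p : ℤ) * k - 1 := orderOf_dvd_iff_zpow_eq_one.mpr h1
  have hp_dvd : (p : ℤ) ∣ (orderOf g : ℤ) := by
    rw [hj]; push_cast; exact dvd_pow_self _ hj0
  have : (p : ℤ) ∣ 1 := by
    have h2 : (p : ℤ) ∣ (p : ℤ) * k - 1 := hp_dvd.trans hdvd
    have h3 : (p : ℤ) ∣ (p : ℤ) * k := dvd_mul_right _ _
    simpa using (Int.dvd_sub h3 h2)
  have hp1 : p ∣ 1 := by exact_mod_cast this
  exact hp.out.one_lt.ne' (Nat.dvd_one.mp hp1)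

/-- **An abelian `p`-group with an element `c ≠ 1` of order `p` inside every non-trivial cyclic subgroup is cyclic**: any element of
maximal order generates (a minimal-order element outside `⟨z₀⟩`, corrected by a power of `z₀`, would have order `p` and contain `c`,
hence lie in `⟨c⟩ ⊆ ⟨z₀⟩`). [folklore] -/
theorem exists_generator_of_forall_mem_zpowers [Fintype G] [DecidableEq G] [hp : Fact p.Prime] (hG : IsPGroup p G)
    (Z : Subgroup G) (hZc : ∀ a ∈ Z, ∀ b ∈ Z, a * b = b * a) {c : G} (hc1 : c ≠ 1) (hcZ : c ∈ Z) (hcp : c ^ p = 1)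
    (hall : ∀ w ∈ Z, w ≠ 1 → c ∈ Subgroup.zpowers w) : ∃ z₀ ∈ Z, ∀ w ∈ Z, w ∈ Subgroup.zpowers z₀ := by
  classical
  have hpri := hp.out
  -- an element of maximal order in `Z`
  set S : Finset G := Finset.univ.filter (· ∈ Z) with hS
  have hSne : S.Nonempty := ⟨1, by simp [hS, Z.one_mem]⟩
  obtain ⟨z₀, hz₀S, hmax⟩ := S.exists_max_image orderOf hSne
  have hz₀Z : z₀ ∈ Z := by simpa [hS] using hz₀S
  refine ⟨z₀, hz₀Z, ?_⟩
  have hoc : orderOf c = p := orderOf_eq_prime hcp hc1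
  -- `z₀ ≠ 1` (its order is at least `p`)
  have hz₀1 : z₀ ≠ 1 := by
    intro h
    have := hmax c (by simpa [hS] using hcZ)
    rw [h, orderOf_one, hoc] at this
    exact absurd this (not_le.mpr hpri.one_lt)
  have hcz₀ : c ∈ Subgroup.zpowers z₀ := hall z₀ hz₀Z hz₀1
  obtain ⟨k, hk⟩ := (IsPGroup.iff_orderOf.mp hG) z₀
  -- suppose some element of `Z` is outside `⟨z₀⟩`; take one of minimal order
  by_contra hcon
  push Not at hcon
  set T : Finset G := Finset.univ.filter (fun w => w ∈ Z ∧ w ∉ Subgroup.zpowers z₀) with hT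
  have hTne : T.Nonempty := by
    obtain ⟨w, hwZ, hw⟩ := hcon
    exact ⟨w, by simpa [hT] using And.intro hwZ hw⟩
  obtain ⟨w, hwT, hmin⟩ := T.exists_min_image orderOf hTne
  have hwZ : w ∈ Z := by have := (Finset.mem_filter.mp hwT).2; exact this.1
  have hw : w ∉ Subgroup.zpowers z₀ := by have := (Finset.mem_filter.mp hwT).2; exact this.2
  have hw1 : w ≠ 1 := fun h => hw (h ▸ Subgroup.one_mem _)
  obtain ⟨j, hj⟩ := (IsPGroup.iff_orderOf.mp hG) w
  have hj0 : j ≠ 0 := by rintro rfl; rw [pow_zero, orderOf_eq_one_iff] at hj; exact hw1 hj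
  obtain ⟨j', rfl⟩ := Nat.exists_eq_succ_of_ne_zero hj0
  -- `w^p` has smaller order, hence lies in `⟨z₀⟩`
  have howp : orderOf (w ^ p) = p ^ j' := by
    rw [orderOf_pow' w hpri.ne_zero, hj, Nat.gcd_eq_right (dvd_pow_self p (Nat.succ_ne_zero j')), pow_succ,
      Nat.mul_div_cancel _ hpri.pos]
  have hwp_lt : orderOf (w ^ p) < orderOf w := by
    rw [howp, hj]; exact Nat.pow_lt_pow_right hpri.one_lt (by omega)
  have hwpZ : w ^ p ∈ Z := Z.pow_mem hwZ p
  have hwp : w ^ p ∈ Subgroup.zpowers z₀ := by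
    by_contra hn
    have := hmin (w ^ p) (by simpa [hT] using And.intro hwpZ hn)
    exact absurd this (not_le.mpr hwp_lt)
  obtain ⟨i, hi⟩ := exists_pow_eq_of_mem_zpowers hwp
  -- `p ∣ i`: otherwise `w^p` has the (maximal) order of `z₀`, but `ord (w^p) < ord w ≤ ord z₀`
  have hle : orderOf w ≤ orderOf z₀ := hmax w (by simpa [hS] using hwZ)
  have hpi : p ∣ i := by
    by_contra hndvd
    have hcop : (orderOf z₀).Coprime i := by
      rw [hk]; exact (Nat.Coprime.pow_left k ((Nat.Prime.coprime_iff_not_dvd hpri).mpr hndvd))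
    have := hcop.orderOf_pow
    rw [hi] at this
    omega
  obtain ⟨i', rfl⟩ := hpi
  -- correct `w` by `z₀^{i'}`: an element of order `p` in `Z` outside `⟨z₀⟩`
  set w' := w * (z₀ ^ i')⁻¹ with hw'
  have hw'Z : w' ∈ Z := Z.mul_mem hwZ (Z.inv_mem (Z.pow_mem hz₀Z _))
  have hcomm : Commute w (z₀ ^ i')⁻¹ := hZc w hwZ _ (Z.inv_mem (Z.pow_mem hz₀Z _))
  have hw'p : w' ^ p = 1 := by
    rw [hw', hcomm.mul_pow, inv_pow, ← hi, ← pow_mul, Nat.mul_comm i' p, mul_inv_cancel]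
  have hw'1 : w' ≠ 1 := by
    intro h
    apply hw
    have : w = z₀ ^ i' := by rw [hw', mul_inv_eq_one] at h; exact h
    rw [this]; exact Subgroup.pow_mem _ (Subgroup.mem_zpowers z₀) _
  have hcw' : c ∈ Subgroup.zpowers w' := hall w' hw'Z hw'1
  -- `w' ∈ ⟨c⟩ ⊆ ⟨z₀⟩`
  have how' : orderOf w' = p := orderOf_eq_prime hw'p hw'1
  obtain ⟨e, he⟩ := exists_pow_eq_of_mem_zpowers hcw'
  have he0 : ¬ p ∣ e := by
    intro hpe
    obtain ⟨e', rfl⟩ := hpe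
    rw [pow_mul, hw'p, one_pow] at he
    exact hc1 he.symm
  have hcop : e.Coprime (orderOf w') := by
    rw [how']; exact Nat.Coprime.symm ((Nat.Prime.coprime_iff_not_dvd hpri).mpr he0)
  obtain ⟨f, hf⟩ := exists_pow_eq_self_of_coprime hcop
  have hw'z₀ : w' ∈ Subgroup.zpowers z₀ := by
    rw [← hf, he]
    exact Subgroup.pow_mem _ hcz₀ f
  apply hw
  have : w = w' * z₀ ^ i' := by rw [hw']; group
  rw [this]
  exact Subgroup.mul_mem _ hw'z₀ (Subgroup.pow_mem _ (Subgroup.mem_zpowers z₀) _)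

/-! ### Minimal bad configurations: non-abelian `p`-groups all of whose proper quotients are abelian -/

section MinBad

variable [Fintype G] [hp : Fact p.Prime]

/-- The centre of a non-abelian finite `p`-group is a non-trivial subgroup. [folklore] -/
theorem center_ne_bot_of_noncomm (hG : IsPGroup p G) (hna : ∃ a b : G, a * b ≠ b * a) : Subgroup.center G ≠ ⊥ := by
  obtain ⟨a, b, hab⟩ := hna
  haveI : Nontrivial G := ⟨⟨a, 1, fun h => hab (by rw [h, one_mul, mul_one])⟩⟩
  exact (hG.bot_lt_center).ne'

/-- **Every commutator is central** when all proper quotients are abelian. [folklore] -/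
theorem comm_mem_center (hG : IsPGroup p G) (hna : ∃ a b : G, a * b ≠ b * a)
    (hquot : ∀ N : Subgroup G, N.Normal → N ≠ ⊥ → ∀ a b : G, a * b * a⁻¹ * b⁻¹ ∈ N) (a b : G) :
    a * b * a⁻¹ * b⁻¹ ∈ Subgroup.center G :=
  hquot _ inferInstance (center_ne_bot_of_noncomm hG hna) a b

omit [Fintype G] hp in
/-- Every commutator lies in `⟨w⟩` for every central `w ≠ 1`, when all proper quotients are abelian. [folklore] -/
theorem comm_mem_zpowers_of_central (hquot : ∀ N : Subgroup G, N.Normal → N ≠ ⊥ → ∀ a b : G, a * b * a⁻¹ * b⁻¹ ∈ N)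
    {w : G} (hw : w ∈ Subgroup.center G) (hw1 : w ≠ 1) (a b : G) : a * b * a⁻¹ * b⁻¹ ∈ Subgroup.zpowers w :=
  hquot _ (normal_of_le_center ((Subgroup.zpowers_le).mpr hw)) (by rwa [Ne, Subgroup.zpowers_eq_bot]) a b

/-- **Commutators have order dividing `p`** when all proper quotients are abelian. [folklore] -/
theorem comm_pow_p (hG : IsPGroup p G) (hna : ∃ a b : G, a * b ≠ b * a)
    (hquot : ∀ N : Subgroup G, N.Normal → N ≠ ⊥ → ∀ a b : G, a * b * a⁻¹ * b⁻¹ ∈ N) (a b : G) :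
    (a * b * a⁻¹ * b⁻¹) ^ p = 1 := by
  by_cases h1 : a * b * a⁻¹ * b⁻¹ = 1
  · rw [h1, one_pow]
  by_contra hne
  have hcen : (a * b * a⁻¹ * b⁻¹) ^ p ∈ Subgroup.center G := Subgroup.pow_mem _ (comm_mem_center hG hna hquot a b) p
  have hmem := comm_mem_zpowers_of_central hquot hcen hne a b
  exact h1 (eq_one_of_mem_zpowers_pow hG hmem)

/-- **`p`-th powers are central** when all proper quotients are abelian: `[g^p, w] = [g, w]^p = 1`. [folklore] -/
theorem pow_p_mem_center (hG : IsPGroup p G) (hna : ∃ a b : G, a * b ≠ b * a)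
    (hquot : ∀ N : Subgroup G, N.Normal → N ≠ ⊥ → ∀ a b : G, a * b * a⁻¹ * b⁻¹ ∈ N) (g : G) :
    g ^ p ∈ Subgroup.center G := by
  rw [Subgroup.mem_center_iff]
  intro w
  have h := comm_pow_left (comm_mem_center hG hna hquot g w) p
  rw [comm_pow_p hG hna hquot g w] at h
  rw [mul_inv_eq_one, mul_inv_eq_iff_eq_mul] at h
  exact h.symm

/-- **The centre is cyclic** when all proper quotients are abelian. [folklore] -/
theorem exists_zpowers_eq_center [DecidableEq G] (hG : IsPGroup p G) (hna : ∃ a b : G, a * b ≠ b * a)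
    (hquot : ∀ N : Subgroup G, N.Normal → N ≠ ⊥ → ∀ a b : G, a * b * a⁻¹ * b⁻¹ ∈ N) :
    ∃ z₀ ∈ Subgroup.center G, ∀ w ∈ Subgroup.center G, w ∈ Subgroup.zpowers z₀ := by
  obtain ⟨a, b, hab⟩ := hna
  have hc1 : a * b * a⁻¹ * b⁻¹ ≠ 1 := by
    intro h; apply hab
    rw [mul_inv_eq_one, mul_inv_eq_iff_eq_mul] at h; exact h
  exact exists_generator_of_forall_mem_zpowers hG (Subgroup.center G)
    (fun a ha b _ => (central_comm ha b).symm) hc1 (comm_mem_center hG ⟨a, b, hab⟩ hquot a b)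
    (comm_pow_p hG ⟨a, b, hab⟩ hquot a b) (fun w hw hw1 => comm_mem_zpowers_of_central hquot hw hw1 a b)

/-- **Case A of the dichotomy**: if every `p`-th power is the `p`-th power of a central element, `G` contains a faithful `He_p`
and is not box-useful (`p ≥ 3`). [folklore] -/
theorem not_boxUseful_of_caseA [DecidableEq G] (hG : IsPGroup p G) (hna : ∃ a b : G, a * b ≠ b * a)
    (hquot : ∀ N : Subgroup G, N.Normal → N ≠ ⊥ → ∀ a b : G, a * b * a⁻¹ * b⁻¹ ∈ N) (h3 : 3 ≤ p)
    (hA : ∀ g : G, ∃ z ∈ Subgroup.center G, g ^ p = z ^ p) : ¬ BoxUseful G := by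
  obtain ⟨x, y, hxy⟩ := hna
  obtain ⟨zx, hzx, hxp⟩ := hA x
  obtain ⟨zy, hzy, hyp⟩ := hA y
  have hx1 : (x * zx⁻¹) ^ p = 1 := by
    rw [(Commute.inv_right (central_comm hzx x)).mul_pow, inv_pow, hxp, mul_inv_cancel]
  have hy1 : (y * zy⁻¹) ^ p = 1 := by
    rw [(Commute.inv_right (central_comm hzy y)).mul_pow, inv_pow, hyp, mul_inv_cancel]
  have hcomm_eq : (y * zy⁻¹) * (x * zx⁻¹) * (y * zy⁻¹)⁻¹ * (x * zx⁻¹)⁻¹ = y * x * y⁻¹ * x⁻¹ := by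
    rw [comm_mul_central_left (Subgroup.inv_mem _ hzy), comm_mul_central_right (Subgroup.inv_mem _ hzx)]
  have hz : (y * zy⁻¹) * (x * zx⁻¹) * (y * zy⁻¹)⁻¹ * (x * zx⁻¹)⁻¹ ∈ Subgroup.center G := by
    rw [hcomm_eq]; exact comm_mem_center hG ⟨x, y, hxy⟩ hquot y x
  have hz1 : (y * zy⁻¹) * (x * zx⁻¹) * (y * zy⁻¹)⁻¹ * (x * zx⁻¹)⁻¹ ≠ 1 := by
    rw [hcomm_eq]
    intro h; apply hxy
    rw [mul_inv_eq_one, mul_inv_eq_iff_eq_mul] at h; exact h.symm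
  exact not_boxUseful_of_heis_generators h3 hx1 hy1 hz hz1

/-- **Case B of the dichotomy**: if some `g` has `g^p ∉ Z^p`, `G` contains a faithful `M_p(m,1)` (`m ≥ 2`) and is not box-useful
(odd prime `p`). [folklore] -/
theorem not_boxUseful_of_caseB [DecidableEq G] (hG : IsPGroup p G) (hna : ∃ a b : G, a * b ≠ b * a)
    (hquot : ∀ N : Subgroup G, N.Normal → N ≠ ⊥ → ∀ a b : G, a * b * a⁻¹ * b⁻¹ ∈ N) (hodd : Odd p) (h3 : 3 ≤ p) {g : G}
    (hB : ∀ z ∈ Subgroup.center G, g ^ p ≠ z ^ p) : ¬ BoxUseful G := by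
  have hpri := hp.out
  haveI : NeZero p := ⟨hpri.ne_zero⟩
  -- the centre is `⟨z₀⟩`, and in fact `⟨g^p⟩`
  obtain ⟨z₀, hz₀, hgen⟩ := exists_zpowers_eq_center hG hna hquot
  have hgpZ : g ^ p ∈ Subgroup.center G := pow_p_mem_center hG hna hquot g
  obtain ⟨i, hi⟩ := exists_pow_eq_of_mem_zpowers (hgen _ hgpZ)
  have hpi : ¬ p ∣ i := by
    rintro ⟨i', rfl⟩
    exact hB (z₀ ^ i') (Subgroup.pow_mem _ hz₀ _) (by rw [← hi, pow_mul'])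
  obtain ⟨k, hk⟩ := (IsPGroup.iff_orderOf.mp hG) z₀
  have hcop : i.Coprime (orderOf z₀) := by
    rw [hk]; exact Nat.Coprime.pow_right k ((Nat.Prime.coprime_iff_not_dvd hpri).mpr hpi).symm
  obtain ⟨f, hf⟩ := exists_pow_eq_self_of_coprime hcop
  have hZg : ∀ w ∈ Subgroup.center G, ∃ n : ℕ, (g ^ p) ^ n = w := by
    intro w hw
    obtain ⟨n, hn⟩ := exists_pow_eq_of_mem_zpowers (hgen w hw)
    exact ⟨f * n, by rw [pow_mul, ← hi, hf, hn]⟩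
  -- `g` is not central; pick `h₀` not commuting with it
  have hgZ : g ∉ Subgroup.center G := fun h => hB g h rfl
  obtain ⟨h₀, hh₀⟩ : ∃ h₀ : G, h₀ * g ≠ g * h₀ := by
    by_contra hall
    push Not at hall
    exact hgZ (Subgroup.mem_center_iff.mpr hall)
  have hc1 : h₀ * g * h₀⁻¹ * g⁻¹ ≠ 1 := by
    intro h; apply hh₀; rw [mul_inv_eq_one, mul_inv_eq_iff_eq_mul] at h; exact h
  obtain ⟨e₀, he₀⟩ := hZg _ (comm_mem_center hG hna hquot h₀ g)
  -- the order of `g` is `p^m` with `m ≥ 2`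
  obtain ⟨m, hm⟩ := (IsPGroup.iff_orderOf.mp hG) g
  have hgp1 : g ^ p ≠ 1 := fun h => hB 1 (Subgroup.one_mem _) (by rw [h, one_pow])
  have hm2 : 2 ≤ m := by
    by_contra hlt
    have : m = 0 ∨ m = 1 := by omega
    rcases this with rfl | rfl
    · rw [pow_zero, orderOf_eq_one_iff] at hm; exact hgp1 (by rw [hm, one_pow])
    · rw [pow_one] at hm; exact hgp1 (by rw [← hm, pow_orderOf_eq_one])
  haveI : Fact (2 ≤ m) := ⟨hm2⟩
  -- the exponent of the commutator: `c₀ = g^{p e₀} = g^{p^{m-1} q}` with `p ∤ q`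
  have hc0p : (h₀ * g * h₀⁻¹ * g⁻¹) ^ p = 1 := comm_pow_p hG hna hquot h₀ g
  have hdiv : p ^ m ∣ p * e₀ * p := by
    rw [← hm]; apply orderOf_dvd_of_pow_eq_one
    rw [pow_mul, pow_mul, he₀, hc0p]
  have hndiv : ¬ p ^ m ∣ p * e₀ := by
    intro h
    apply hc1
    rw [← he₀, ← pow_mul]
    rw [← hm] at h
    exact orderOf_dvd_iff_pow_eq_one.mp h
  obtain ⟨q, hq⟩ : p ^ (m - 1) ∣ p * e₀ := by
    have e2 : p ^ m = p ^ (m - 1) * p := by rw [← pow_succ]; congr 1; omega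
    rw [e2] at hdiv
    exact Nat.dvd_of_mul_dvd_mul_right hpri.pos hdiv
  have hqp : ¬ p ∣ q := by
    rintro ⟨q', rfl⟩
    apply hndiv
    rw [hq, show p ^ (m - 1) * (p * q') = p ^ (m - 1 + 1) * q' by ring, show m - 1 + 1 = m by omega]
    exact dvd_mul_right _ _
  have hconj0 : h₀ * g * h₀⁻¹ = g ^ (1 + p ^ (m - 1) * q) := by
    have e1 : h₀ * g * h₀⁻¹ = (h₀ * g * h₀⁻¹ * g⁻¹) * g := by group
    rw [e1, ← he₀, ← pow_mul, hq, ← pow_succ, add_comm]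
  -- fix the `p`-th power of `h₀` by a power of `g` (Hall's formula, `p` odd)
  obtain ⟨r, hr⟩ := hZg _ (pow_p_mem_center hG hna hquot h₀)
  obtain ⟨h₁, hh₁⟩ : ∃ h₁, h₁ = h₀ * (g ^ r)⁻¹ := ⟨_, rfl⟩
  have hh₁p : h₁ ^ p = 1 := by
    have hd : ((g ^ r)⁻¹)⁻¹ * h₀⁻¹ * (g ^ r)⁻¹ * h₀ ∈ Subgroup.center G := by
      have := comm_mem_center hG hna hquot (g ^ r) h₀⁻¹
      simpa only [inv_inv] using this
    have hdp : (((g ^ r)⁻¹)⁻¹ * h₀⁻¹ * (g ^ r)⁻¹ * h₀) ^ p = 1 := by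
      have := comm_pow_p hG hna hquot (g ^ r) h₀⁻¹
      simpa only [inv_inv] using this
    rw [hh₁, mul_pow_prime_of_comm_central hpri h3 hd hdp, inv_pow, pow_right_comm, hr, mul_inv_cancel]
  have hconj1 : h₁ * g * h₁⁻¹ = g ^ (1 + p ^ (m - 1) * q) := by
    rw [hh₁, ← hconj0]; group
  -- normalise the exponent: `d` with `q d ≡ 1 (mod p)`
  obtain ⟨d, -, hd1⟩ := Nat.exists_mul_mod_eq_one_of_coprime
    ((Nat.Prime.coprime_iff_not_dvd hpri).mpr hqp).symm hpri.one_lt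
  obtain ⟨h, hhd⟩ : ∃ h, h = h₁ ^ d := ⟨_, rfl⟩
  have hhp : h ^ p = 1 := by rw [hhd, ← pow_mul, mul_comm, pow_mul, hh₁p, one_pow]
  have hconj : h * g * h⁻¹ = g ^ (1 + p ^ (m - 1)) := by
    rw [hhd, conj_pow_eq_pow_pow hconj1 d]
    obtain ⟨s, hs⟩ := one_add_pow_pred_mul_pow (p := p) hm2 q d
    obtain ⟨t, ht⟩ : ∃ t, q * d = p * t + 1 := ⟨q * d / p, by
      have := (Nat.div_add_mod (q * d) p).symm
      rwa [hd1] at this⟩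
    have e2 : p ^ m = p * p ^ (m - 1) := by rw [← pow_succ']; congr 1; omega
    have hexp : 1 + d * q * p ^ (m - 1) + p ^ m * s = (1 + p ^ (m - 1)) + p ^ m * (t + s) := by
      rw [mul_comm d q, ht, e2]; ring
    rw [hs, hexp, pow_add g (1 + p ^ (m - 1)), pow_mul g (p ^ m), ← hm, pow_orderOf_eq_one, one_pow, mul_one]
  have hog : orderOf g = p ^ m := hm
  have hng : h ∉ Subgroup.zpowers g := by
    intro hmem
    obtain ⟨n, hn⟩ := exists_pow_eq_of_mem_zpowers hmem
    have hcomm : h * g * h⁻¹ = g := by rw [← hn]; group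
    rw [hconj, pow_add, pow_one] at hcomm
    have h1 : g ^ p ^ (m - 1) = 1 := mul_left_cancel (hcomm.trans (mul_one g).symm)
    have hdvd : p ^ m ∣ p ^ (m - 1) := by rw [← hog]; exact orderOf_dvd_of_pow_eq_one h1
    have hlt : p ^ (m - 1) < p ^ m := Nat.pow_lt_pow_right hpri.one_lt (by omega)
    exact absurd (Nat.le_of_dvd (pow_pos hpri.pos _) hdvd) (not_le.mpr hlt)
  exact not_boxUseful_of_mmeta_generators hodd h3 hog hhp hconj hng

/-- **A non-abelian finite `p`-group all of whose proper quotients are abelian is NOT box-useful** (`p ≥ 3` prime): Case A gives a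
faithful `He_p`, Case B a faithful `M_p(m,1)`. [folklore] -/
theorem not_boxUseful_of_quot_comm [DecidableEq G] (hG : IsPGroup p G) (hna : ∃ a b : G, a * b ≠ b * a)
    (hquot : ∀ N : Subgroup G, N.Normal → N ≠ ⊥ → ∀ a b : G, a * b * a⁻¹ * b⁻¹ ∈ N) (hodd : Odd p) (h3 : 3 ≤ p) :
    ¬ BoxUseful G := by
  by_cases hA : ∀ g : G, ∃ z ∈ Subgroup.center G, g ^ p = z ^ p
  · exact not_boxUseful_of_caseA hG hna hquot h3 hA
  · push Not at hA
    obtain ⟨g, hg⟩ := hA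
    exact not_boxUseful_of_caseB hG hna hquot hodd h3 hg

end MinBad


end OddPGroup

end Summit.MatrixMultiplication.OmegaCensus
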